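import Literature.Barriers.SmoothPoincare4.ExoticOpenFourSpaceSmoothHeightProofs
import Literature.Analysis.Calculus.SardProofs
import Literature.Geometry.Manifold.OpenSubmanifoldMFDeriv
import Mathlib.Topology.MetricSpace.Thickening
import Mathlib.MeasureTheory.Measure.Regular
import HarnessLib

/-!
# `deMichelisFreedman1992_continuum`: the "bounded geometry" hypotheses (1)–(2) of Appendix B
# hold for the end-periodic end (DeMichelis–Freedman 1992, App. B, p. 251)

Proof file in the cone of the named fact
`Literature.Barriers.SmoothPoincare4.deMichelisFreedman1992_continuum` (DeMichelis–Freedman 1992,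
Thm. 4.1 with Cor. 4.1), sibling of `ExoticOpenFourSpaceSmoothHeightProofs` (the `C^∞` Taubes
height function `τ`), `ExoticOpenFourSpaceEndPeriodicMetricProofs` (the end-periodic metrics
`M_n`, `M_∞`, the deck isometry) and `ExoticOpenFourSpaceEnergyDecayProofs` (the closing step
(B.8) ⇒ (B.9) of Appendix B).

Appendix B ("`L²` implies `L²_δ`", pp. 251–253) proves exponential decay of the energy
`I_t = ∫_{τ ≥ t} |F_A|²` of a finite-energy ASD connection over an end `E ≅ S³ × ℝ` of bounded
geometry, for a proper Morse function `τ : E → [0, ∞)`; the analysis rests on two standing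
consequences of the hypotheses, stated on p. 251 WITHOUT PROOF:

> "The other hypotheses imply: (1) (After a linear rescaling of `τ`) a topological factor
> 3-sphere lies in each segment `τ⁻¹[i, i + 1]`, and (2) there exist constants `0 < b < c` and a
> closed subset `Δ ⊂ [0, ∞)` such that `b < |grad τ(x)| < c` for `x ∈ τ⁻¹(ℝ⁺ − Δ)` and where the
> measure of `Δ` intersected with any interval of length one is smaller than `½`."

THIS FILE proves (1) and (2) in the case the paper needs them (Thm. 2.1, proof of Thm. 4.1,
p. 247: "this allows the construction of end periodic metrics, so that Theorem 2.1 applies"):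
the end-periodic end `U ∖ ⋂ₖ σ^[k](U)` of `ExoticOpenFourSpaceEndPeriodicMetricProofs`
(`EndPeriodicData`: `σ = incl ∘ φ⁻¹ : U → U` for a diffeomorphism `φ : V ≅ U` of open subsets of a
finite-dimensional `E`, `σ(U) ⊆ C` compact), with a Riemannian metric `g` on the end invariant
under the deck transformation `σ` (the pulled-back metric `π^* g_Y`, `pullbackBilin_deck_coverMetric`;
`M_∞` beyond the first ring, `pullbackBilin_deck_eq_of_eqOn`) and a `C^∞` height function with
`τ ∘ σ = τ + 1` (`exists_smooth_height_function`).

* `EndPeriodicData.gradNormSq g τ y = |grad τ|²_g (y) = g⁻¹(dτ_y, dτ_y)` — the squared length of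
  the gradient, via the inverse metric `PseudoRiemannianMetric.innerDual` (with the abbreviations
  `valE` — the metric at a point as a bilinear form on `E = T_y End` — and `dEnd` — the
  differential `dτ_y : E →L ℝ`); `gradNormSq_nonneg`, `gradNormSq_congr` (it depends on `g_y` only).
* (2) `EndPeriodicData.exists_gradient_bounds` — **there are `0 < b < c` and a closed `Δ ⊆ ℝ`
  meeting every interval of length one in measure `< ½` with `b < |grad τ|_g < c` off `τ⁻¹(Δ)`**
  (and `|grad τ|_g < c` everywhere); `exists_gradient_bounds_of_eqOn` — the same for any metric
  agreeing with `g` beyond the first ring (`M_∞`). Proof: `|grad τ|_g` is `σ`-invariant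
  (`gradNormSq_deck`: the deck transformation is an isometry and `d(τ ∘ σ) = dτ`,
  `dEnd_deck_comp`), every orbit meets the compact set `C ∖ σ²(U)`
  (`exists_mem_fundamentalSet_rel`), on which `g` is uniformly equivalent to the ambient norm
  (`exists_uniform_bounds`, from the continuity of `g` as a map into the bilinear forms of `E`,
  `continuous_metric_val` — the trivializations of the tangent bundle of the end are the identity)
  and `‖dτ‖` is bounded (`continuous_dEnd`: `dτ` is the Fréchet derivative of the extension of `τ`
  to `E`, `hasMFDerivAt_restrict_end`), and bounded below off a neighbourhood of the critical set;
  the critical VALUES on `C ∖ σ²(U)` form a compact Lebesgue-null set by **Sard's theorem**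
  (`volume_image_setOf_dEnd_eq_zero`, from
  `Literature.Analysis.Calculus.measure_image_setOf_not_surjective_fderiv_eq_zero`, PROVED in
  `SardProofs`), all critical values are its `ℤ`-translates (`τ ∘ σ = τ + 1`,
  `dEnd_deck_eq_zero_iff`), and `Δ` is the `ℤ`-saturation of a compact `δ`-neighbourhood
  (`δ ≤ 1`) of it of measure `< 1 / (2 (w + 8))`, `w` the oscillation of `τ` on `C ∖ σ²(U)` — a
  locally finite union of closed sets, meeting each `[a, a + 1]` in at most `w + 4` translates.
* (1) `EndPeriodicData.height_mem_Icc_of_mem_image_iterate_link`, `compl_image_iterate_link`: the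
  compact "link" `L = C ∖ σ(U)` of the fundamental domain (`isCompact_link`) has its iterates
  `σ^[k](L) = σ^[k](C) ∖ σ^[k+1](U)` (`image_iterate_link`) inside the segments `{k ≤ τ ≤ k + 1}`,
  each separating `U` into the open end side `σ^[k+1](U)` (containing the end compactum) and the
  open outside `U ∖ σ^[k](C)`; for the polar family (`polarEndPeriodicData`) `L` is the polar
  sphere `{(1 - s) ‖e x‖ = 1}` (`polar_link_eq`), homeomorphic to the unit sphere of `E` (`S³` for
  `E = ℝ⁴`), `polarLinkHomeomorph`, `nonempty_polar_link_homeomorph_sphere`.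
* `exists_boundedGeometry_of_diffeomorph` — (1) and (2) packaged for the end that a diffeomorphism
  `d : R⁴_s ≅ R⁴_t`, `s < t`, of the polar family produces, with the `C^∞` Taubes height function
  of `exists_smooth_height_function` and the metric `M_∞` of
  `exists_endPeriodicMetrics_of_diffeomorph` (any metric agreeing with `π^* g_Y` beyond the first
  ring).

Scope: only the hypotheses (1)–(2) are rendered; the decay estimates (B.1)–(B.8) are Yang–Mills
analysis (Chern–Simons functional, first eigenvalue of `curl`, Appendix A) and are not formalized
(no ASD connections in Mathlib); the closing step (B.8) ⇒ (B.9) is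
`deMichelisFreedman1992_appendixB_exp_decay`. The source's `Δ ⊂ [0, ∞)`: here `Δ ⊆ ℝ` (intersect
with `[0, ∞)`; the tree's `τ` is `≥ 0`). Sard's theorem is used with source and target in
`Type` (the universe discipline of its Literature statement), so (2) is stated for `E : Type`.
No new named facts (D-0026).

## References

* S. DeMichelis, M. H. Freedman, *Uncountably many exotic `R⁴`'s in standard 4-space*,
  J. Differential Geom. 35 (1992) 219–254, Appendix B (p. 251), §2 (p. 223), proof of Thm. 4.1
  (p. 247) [DeMichelisFreedman1992].
* C. H. Taubes, *Gauge theory on asymptotically periodic 4-manifolds*, J. Differential Geom. 25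
  (1987) 363–430, §1, Prop. 10.5 [Taubes1987].
* A. Sard, *The measure of the critical values of differentiable maps*, Bull. AMS 48 (1942)
  883–890 [Sard1942].

[DeMichelisFreedman1992]
-/

noncomputable section

open scoped Manifold ContDiff Topology
open TopologicalSpace Set Function Filter MeasureTheory Metric Bundle

namespace Literature.Barriers.SmoothPoincare4

namespace EndPeriodicData

open EndPeriodic Literature.Geometry.Lorentzian Literature.Geometry.Lorentzian.PseudoRiemannianMetric
  Literature.Geometry.Manifold

section General

variable {E : Type*} [NormedAddCommGroup E] [NormedSpace ℝ E] (D : EndPeriodicData E)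

/-! #### Pointwise linear algebra: the inverse metric against the operator norm -/

/-- The metric `g_y` at a point `y` of the end as a continuous bilinear form on `E`
(`T_y End = E`). [folklore] -/
abbrev valE (g : PseudoRiemannianMetric 𝓘(ℝ, E) ∞ E (TangentSpace 𝓘(ℝ, E) : D.End → Type _))
    (y : D.End) : E →L[ℝ] E →L[ℝ] ℝ :=
  g.val y

/-- `valE` is the metric. [folklore] -/
theorem valE_apply (g : PseudoRiemannianMetric 𝓘(ℝ, E) ∞ E (TangentSpace 𝓘(ℝ, E) : D.End → Type _))
    (y : D.End) (v w : E) : D.valE g y v w = g.val y v w :=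
  rfl

section Pointwise

variable {D}
variable [FiniteDimensional ℝ E]
  (g : PseudoRiemannianMetric 𝓘(ℝ, E) ∞ E (TangentSpace 𝓘(ℝ, E) : D.End → Type _)) (y : D.End)

omit [FiniteDimensional ℝ E] in
/-- A Riemannian metric is positive semidefinite: `0 ≤ g(u, u)` (vectors of `T_y End = E`).
[folklore] -/
theorem val_self_nonneg (hR : g.IsRiemannian) (u : E) : 0 ≤ D.valE g y u u := by
  by_cases hu : u = 0
  · rw [hu, map_zero]
  · exact (hR y u hu).le

omit [FiniteDimensional ℝ E] in
/-- **Cauchy–Schwarz** for a Riemannian metric: `g(w, v)² ≤ g(w, w) g(v, v)`. [folklore] -/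
theorem val_sq_le (hR : g.IsRiemannian) (w v : E) :
    (D.valE g y w v) ^ 2 ≤ D.valE g y w w * D.valE g y v v := by
  set G : E →L[ℝ] E →L[ℝ] ℝ := D.valE g y with hG
  by_cases hv : v = 0
  · subst hv
    simp only [map_zero, mul_zero, le_refl, pow_two]
  have hq : 0 < G v v := hR y v hv
  have hsymm : G v w = G w v := g.symm y v w
  -- expand `0 ≤ g(w - t v, w - t v)` for `t = g(w, v) / g(v, v)`
  have hexp : G (w - (G w v / G v v) • v) (w - (G w v / G v v) • v) =
      G w w - (G w v) ^ 2 / G v v := by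
    simp only [map_sub, map_smul, sub_apply, smul_apply, smul_eq_mul, hsymm]
    field_simp
    ring
  have h0 : 0 ≤ G w w - (G w v) ^ 2 / G v v := hexp ▸ val_self_nonneg g y hR _
  have h1 : (G w v) ^ 2 / G v v ≤ G w w := by linarith
  rwa [div_le_iff₀ hq] at h1

/-- `g⁻¹(α, α) = g(♯α, ♯α) ≥ 0` for a Riemannian metric. [folklore] -/
theorem innerDual_self_nonneg (hR : g.IsRiemannian) (α : Module.Dual ℝ (TangentSpace 𝓘(ℝ, E) y)) :
    0 ≤ g.innerDual y α α := by
  rw [innerDual_eq_val_sharp_sharp]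
  exact val_self_nonneg g y hR _

/-- **Upper bound for the inverse metric**: if `m ‖v‖² ≤ g(v, v)` for all `v` (`m > 0`) then
`g⁻¹(ℓ, ℓ) ≤ ‖ℓ‖² / m` for every continuous linear functional `ℓ` (`g⁻¹(ℓ, ℓ) = ℓ(♯ℓ) ≤ ‖ℓ‖ ‖♯ℓ‖`
and `m ‖♯ℓ‖² ≤ g(♯ℓ, ♯ℓ) = ℓ(♯ℓ)`). [folklore] -/
theorem innerDual_le_of_lower {m : ℝ} (hm : 0 < m)
    (hlow : ∀ v : E, m * ‖v‖ ^ 2 ≤ D.valE g y v v) (ℓ : E →L[ℝ] ℝ) :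
    g.innerDual y (ℓ : E →ₗ[ℝ] ℝ) (ℓ : E →ₗ[ℝ] ℝ) ≤ ‖ℓ‖ ^ 2 / m := by
  set w : E := g.sharp y (ℓ : E →ₗ[ℝ] ℝ) with hw
  have hI : g.innerDual y (ℓ : E →ₗ[ℝ] ℝ) (ℓ : E →ₗ[ℝ] ℝ) = ℓ w := rfl
  have hIw : D.valE g y w w = ℓ w := by
    rw [hw]
    exact val_sharp_apply g y (ℓ : E →ₗ[ℝ] ℝ) _
  have h1 : m * ‖w‖ ^ 2 ≤ ℓ w := hIw ▸ hlow w
  have h2 : ℓ w ≤ ‖ℓ‖ * ‖w‖ :=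
    (le_abs_self _).trans ((Real.norm_eq_abs _).symm.le.trans (ℓ.le_opNorm w))
  rw [hI]
  rcases (norm_nonneg w).eq_or_lt with h0 | hpos
  · have hw0 : w = 0 := norm_eq_zero.1 h0.symm
    rw [hw0, map_zero]
    positivity
  · have h3 : m * ‖w‖ ≤ ‖ℓ‖ := by
      by_contra h
      push Not at h
      nlinarith
    have h4 : ‖w‖ ≤ ‖ℓ‖ / m := by rwa [le_div_iff₀ hm, mul_comm]
    calc ℓ w ≤ ‖ℓ‖ * ‖w‖ := h2
      _ ≤ ‖ℓ‖ * (‖ℓ‖ / m) := by gcongr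
      _ = ‖ℓ‖ ^ 2 / m := by ring

/-- **Lower bound for the inverse metric**: if `g(v, v) ≤ M ‖v‖²` for all `v` (`M > 0`) then
`‖ℓ‖² ≤ M g⁻¹(ℓ, ℓ)` (`ℓ(v)² = g(♯ℓ, v)² ≤ g(♯ℓ, ♯ℓ) g(v, v)` by Cauchy–Schwarz). [folklore] -/
theorem sq_norm_le_of_upper (hR : g.IsRiemannian) {M : ℝ} (hM : 0 < M)
    (hup : ∀ v : E, D.valE g y v v ≤ M * ‖v‖ ^ 2) (ℓ : E →L[ℝ] ℝ) :
    ‖ℓ‖ ^ 2 ≤ M * g.innerDual y (ℓ : E →ₗ[ℝ] ℝ) (ℓ : E →ₗ[ℝ] ℝ) := by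
  set G : E →L[ℝ] E →L[ℝ] ℝ := D.valE g y with hG
  set w : E := g.sharp y (ℓ : E →ₗ[ℝ] ℝ) with hw
  set I := g.innerDual y (ℓ : E →ₗ[ℝ] ℝ) (ℓ : E →ₗ[ℝ] ℝ) with hI_def
  have hI0 : 0 ≤ I := innerDual_self_nonneg g y hR _
  have hℓv : ∀ v : E, ℓ v = G w v := fun v => by
    rw [hw, hG]
    exact (val_sharp_apply g y (ℓ : E →ₗ[ℝ] ℝ) v).symm
  have hIw : G w w = I := by
    rw [← hℓv]
    rfl
  have hbound : ∀ v, ‖ℓ v‖ ≤ Real.sqrt (I * M) * ‖v‖ := by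
    intro v
    have h1 : (ℓ v) ^ 2 ≤ I * M * ‖v‖ ^ 2 := by
      calc (ℓ v) ^ 2 = (G w v) ^ 2 := by rw [hℓv]
        _ ≤ G w w * G v v := val_sq_le g y hR w v
        _ ≤ I * (M * ‖v‖ ^ 2) := by
            rw [hIw]
            exact mul_le_mul_of_nonneg_left (hup v) hI0
        _ = I * M * ‖v‖ ^ 2 := by ring
    rw [Real.norm_eq_abs]
    calc |ℓ v| ≤ Real.sqrt (I * M * ‖v‖ ^ 2) := Real.abs_le_sqrt h1
      _ = Real.sqrt (I * M) * ‖v‖ := by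
          rw [Real.sqrt_mul (by positivity), Real.sqrt_sq (norm_nonneg _)]
  have hop : ‖ℓ‖ ≤ Real.sqrt (I * M) := ℓ.opNorm_le_bound (Real.sqrt_nonneg _) hbound
  calc ‖ℓ‖ ^ 2 ≤ (Real.sqrt (I * M)) ^ 2 := by gcongr
    _ = I * M := Real.sq_sqrt (by positivity)
    _ = M * I := mul_comm _ _

/-- The inverse metric at a point depends only on the metric at that point. [folklore] -/
theorem innerDual_congr_val
    (g' : PseudoRiemannianMetric 𝓘(ℝ, E) ∞ E (TangentSpace 𝓘(ℝ, E) : D.End → Type _))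
    (h : g.val y = g'.val y) (α β : Module.Dual ℝ (TangentSpace 𝓘(ℝ, E) y)) :
    g.innerDual y α β = g'.innerDual y α β := by
  have hsharp : g.sharp y β = g'.sharp y β := by
    apply g.flat_injective y
    apply LinearMap.ext
    intro w
    rw [flat_apply, flat_apply, val_sharp_apply, h, val_sharp_apply]
  show α (g.sharp y β) = α (g'.sharp y β)
  rw [hsharp]

end Pointwise

/-! #### The squared length of the gradient of a function on the end -/

section GradNorm

/-- The differential `dτ_y` of `τ` (restricted to the end) at a point `y` of the end, as a
covector on `T_y End = E`. [folklore] -/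
abbrev dEnd (τ : D.U → ℝ) (y : D.End) : E →L[ℝ] ℝ :=
  mfderiv 𝓘(ℝ, E) 𝓘(ℝ) (fun z : D.End => τ z) y

variable [FiniteDimensional ℝ E]

/-- **`|grad τ|²_g (y)`**, the squared length of the gradient of `τ` at the point `y` of the end
for the metric `g`: `g⁻¹(dτ_y, dτ_y) = dτ_y(♯ dτ_y) = g(grad τ, grad τ)` with `grad τ = ♯ dτ`
(App. B: "`b < |grad τ(x)| < c`"). [cite: DeMichelisFreedman1992, App. B (p. 251)] -/
def gradNormSq (g : PseudoRiemannianMetric 𝓘(ℝ, E) ∞ E (TangentSpace 𝓘(ℝ, E) : D.End → Type _))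
    (τ : D.U → ℝ) (y : D.End) : ℝ :=
  g.innerDual y (D.dEnd τ y : E →ₗ[ℝ] ℝ) (D.dEnd τ y : E →ₗ[ℝ] ℝ)

/-- Unfolding `gradNormSq`. [folklore] -/
theorem gradNormSq_def (g : PseudoRiemannianMetric 𝓘(ℝ, E) ∞ E (TangentSpace 𝓘(ℝ, E) : D.End → Type _))
    (τ : D.U → ℝ) (y : D.End) :
    D.gradNormSq g τ y = g.innerDual y (D.dEnd τ y : E →ₗ[ℝ] ℝ) (D.dEnd τ y : E →ₗ[ℝ] ℝ) :=
  rfl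

/-- `|grad τ|²_g ≥ 0` for a Riemannian `g`. [folklore] -/
theorem gradNormSq_nonneg {g : PseudoRiemannianMetric 𝓘(ℝ, E) ∞ E (TangentSpace 𝓘(ℝ, E) : D.End → Type _)}
    (hR : g.IsRiemannian) (τ : D.U → ℝ) (y : D.End) : 0 ≤ D.gradNormSq g τ y :=
  innerDual_self_nonneg g y hR _

/-- `|grad τ|²_g (y)` depends only on `g_y`: two metrics which agree at `y` give the same value.
[folklore] -/
theorem gradNormSq_congr {g g' : PseudoRiemannianMetric 𝓘(ℝ, E) ∞ E (TangentSpace 𝓘(ℝ, E) : D.End → Type _)}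
    {y : D.End} (h : g.val y = g'.val y) (τ : D.U → ℝ) :
    D.gradNormSq g τ y = D.gradNormSq g' τ y :=
  innerDual_congr_val g y g' h _ _

end GradNorm

/-! #### The metric as a continuous map into the bilinear forms of `E` -/

section MetricContinuity

/-- On the end (an open submanifold of an open subset of `E`) all preferred charts are the
double coercion, so the preferred trivializations of the tangent bundle are the identity.
[folklore] -/
theorem trivializationAt_tangent_apply (y₀ : D.End) (z : TangentBundle 𝓘(ℝ, E) D.End) :
    trivializationAt E (TangentSpace 𝓘(ℝ, E)) y₀ z = (z.1, z.2) := by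
  rw [TangentBundle.trivializationAt_apply]
  congr 1
  change (tangentBundleCore 𝓘(ℝ, E) D.End).coordChange (achart E z.1) (achart E z.1) z.1 z.2 = z.2
  exact (tangentBundleCore 𝓘(ℝ, E) D.End).coordChange_self _ _ (mem_chart_source _ _) _

/-- Every point of the end lies in the base set of every preferred trivialization of its tangent
bundle. [folklore] -/
theorem mem_baseSet_trivializationAt_tangent (y₀ y : D.End) :
    y ∈ (trivializationAt E (TangentSpace 𝓘(ℝ, E)) y₀).baseSet :=
  mem_chartAt_source_opens_opens D.End y₀ y

/-- The fibrewise linear part of the preferred trivializations of the tangent bundle of the end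
is the identity. [folklore] -/
theorem continuousLinearMapAt_tangent_apply (y₀ y : D.End) (v : TangentSpace 𝓘(ℝ, E) y) :
    (trivializationAt E (TangentSpace 𝓘(ℝ, E)) y₀).continuousLinearMapAt ℝ y v = v := by
  rw [Trivialization.continuousLinearMapAt_apply, Trivialization.linearMapAt_apply,
    if_pos (D.mem_baseSet_trivializationAt_tangent y₀ y)]
  exact congrArg Prod.snd (D.trivializationAt_tangent_apply y₀ ⟨y, v⟩)

/-- The inverses of the preferred trivializations of the tangent bundle of the end are the
identity on fibres. [folklore] -/
theorem symm_tangent_apply (y₀ y : D.End) (v : E) :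
    (trivializationAt E (TangentSpace 𝓘(ℝ, E)) y₀).symm y v = v := by
  have := (trivializationAt E (TangentSpace 𝓘(ℝ, E)) y₀).symm_apply_apply_mk
    (D.mem_baseSet_trivializationAt_tangent y₀ y) v
  rwa [show (trivializationAt E (TangentSpace 𝓘(ℝ, E)) y₀) ⟨y, v⟩ = (y, v) from
    D.trivializationAt_tangent_apply y₀ ⟨y, v⟩] at this

/-- The inverse fibre maps `symmL` of the preferred trivializations of the tangent bundle of the
end are the identity. [folklore] -/
theorem symmL_tangent_apply (y₀ y : D.End) (v : E) :
    (trivializationAt E (TangentSpace 𝓘(ℝ, E)) y₀).symmL ℝ y v = v := by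
  rw [Trivialization.symmL_apply _ (D.mem_baseSet_trivializationAt_tangent y₀ y)]
  exact D.symm_tangent_apply y₀ y v

/-- In the preferred trivializations, the coordinate expression of a field of bilinear forms on
the end is the field itself. [folklore] -/
theorem hom₂_trivializationAt_snd (y₀ y : D.End)
    (s : TangentSpace 𝓘(ℝ, E) y →L[ℝ] TangentSpace 𝓘(ℝ, E) y →L[ℝ] ℝ) :
    ((trivializationAt (E →L[ℝ] E →L[ℝ] ℝ)
      (fun x : D.End => TangentSpace 𝓘(ℝ, E) x →L[ℝ] TangentSpace 𝓘(ℝ, E) x →L[ℝ] ℝ) y₀) ⟨y, s⟩).2 =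
      (s : E →L[ℝ] E →L[ℝ] ℝ) := by
  ext v w
  rw [hom_trivializationAt_apply]
  simp only [ContinuousLinearMap.inCoordinates, ContinuousLinearMap.comp_apply]
  rw [D.symmL_tangent_apply, Trivialization.continuousLinearMapAt_apply,
    Trivialization.linearMapAt_apply,
    if_pos (by simpa [hom_trivializationAt_baseSet] using mem_chartAt_source_opens_opens D.End y₀ y)]
  change ((trivializationAt (E →L[ℝ] ℝ)
    (fun x : D.End => TangentSpace 𝓘(ℝ, E) x →L[ℝ] Bundle.Trivial D.End ℝ x) y₀) ⟨y, s v⟩).2 w = s v w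
  rw [hom_trivializationAt_apply]
  simp only [ContinuousLinearMap.inCoordinates, ContinuousLinearMap.comp_apply]
  rw [D.symmL_tangent_apply]
  simp

/-- **A `C^∞` metric on the end is `C^∞` as a map into the normed space of bilinear forms on
`E`** (the trivializations being the identity). [folklore] -/
theorem contMDiff_metric_val
    (g : PseudoRiemannianMetric 𝓘(ℝ, E) ∞ E (TangentSpace 𝓘(ℝ, E) : D.End → Type _)) :
    ContMDiff 𝓘(ℝ, E) 𝓘(ℝ, E →L[ℝ] E →L[ℝ] ℝ) ∞ (fun y : D.End => D.valE g y) := by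
  intro y₀
  have h := (contMDiffAt_section (x₀ := y₀)).1 (g.contMDiff y₀)
  refine h.congr_of_eventuallyEq (Eventually.of_forall fun y => ?_)
  exact (D.hom₂_trivializationAt_snd y₀ y (g.val y)).symm

/-- A `C^∞` metric on the end is continuous as a map into the bilinear forms on `E`. [folklore] -/
theorem continuous_metric_val
    (g : PseudoRiemannianMetric 𝓘(ℝ, E) ∞ E (TangentSpace 𝓘(ℝ, E) : D.End → Type _)) :
    Continuous (fun y : D.End => D.valE g y) :=
  (D.contMDiff_metric_val g).continuous

/-- **Uniform equivalence with the ambient norm on compact sets**: on a compact subset `K` of the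
end a Riemannian metric satisfies `m ‖v‖² ≤ g_y(v, v) ≤ M ‖v‖²` (`y ∈ K`) for some `0 < m`,
`0 < M`. [folklore] -/
theorem exists_uniform_bounds [FiniteDimensional ℝ E]
    (g : PseudoRiemannianMetric 𝓘(ℝ, E) ∞ E (TangentSpace 𝓘(ℝ, E) : D.End → Type _))
    (hR : g.IsRiemannian) {K : Set D.End} (hK : IsCompact K) :
    ∃ m M : ℝ, 0 < m ∧ 0 < M ∧ ∀ y ∈ K, ∀ v : E,
      m * ‖v‖ ^ 2 ≤ D.valE g y v v ∧ D.valE g y v v ≤ M * ‖v‖ ^ 2 := by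
  have hG := D.continuous_metric_val g
  -- the continuous function `(y, v) ↦ g_y(v, v)` on the compact `K × unit sphere`
  have hφ : Continuous fun p : D.End × E => D.valE g p.1 p.2 p.2 :=
    ((hG.comp continuous_fst).clm_apply continuous_snd).clm_apply continuous_snd
  have hS : IsCompact (K ×ˢ sphere (0 : E) 1) := hK.prod (isCompact_sphere 0 1)
  have hscale : ∀ (y : D.End) (v : E) (c : ℝ),
      D.valE g y (c • v) (c • v) = c ^ 2 * D.valE g y v v := by
    intro y v c
    simp only [map_smul, smul_apply, smul_eq_mul]
    ring
  have hunit : ∀ y ∈ K, ∀ v : E, v ≠ 0 →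
      (y, ‖v‖⁻¹ • v) ∈ K ×ˢ sphere (0 : E) 1 ∧
        D.valE g y v v = ‖v‖ ^ 2 * D.valE g y (‖v‖⁻¹ • v) (‖v‖⁻¹ • v) := by
    intro y hy v hv
    have hn : ‖v‖ ≠ 0 := norm_ne_zero_iff.2 hv
    refine ⟨⟨hy, by simp [norm_smul, inv_mul_cancel₀ hn]⟩, ?_⟩
    have hv' : v = ‖v‖ • (‖v‖⁻¹ • v) := by rw [smul_smul, mul_inv_cancel₀ hn, one_smul]
    conv_lhs => rw [hv']
    rw [hscale]
  have hzero : ∀ y : D.End, D.valE g y (0 : E) 0 = 0 := fun y => by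
    simp only [map_zero]
  rcases (K ×ˢ sphere (0 : E) 1).eq_empty_or_nonempty with hempty | hne
  · refine ⟨1, 1, one_pos, one_pos, fun y hy v => ?_⟩
    have hv : v = 0 := by
      by_contra hv
      have hmem := (hunit y hy v hv).1
      rw [hempty] at hmem
      exact hmem
    subst hv
    rw [hzero, norm_zero, sq, mul_zero, mul_zero]
    exact ⟨le_rfl, le_rfl⟩
  · obtain ⟨p₀, hp₀, hmin⟩ := hS.exists_isMinOn hne hφ.continuousOn
    obtain ⟨p₁, hp₁, hmax⟩ := hS.exists_isMaxOn hne hφ.continuousOn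
    have hp₀2 : p₀.2 ≠ 0 := by
      have : ‖p₀.2‖ = 1 := by simpa using hp₀.2
      exact norm_ne_zero_iff.1 (by rw [this]; exact one_ne_zero)
    refine ⟨D.valE g p₀.1 p₀.2 p₀.2, max (D.valE g p₁.1 p₁.2 p₁.2) 1, hR p₀.1 p₀.2 hp₀2,
      lt_max_of_lt_right one_pos, fun y hy v => ?_⟩
    by_cases hv : v = 0
    · subst hv
      rw [hzero, norm_zero, sq, mul_zero, mul_zero, mul_zero]
      exact ⟨le_rfl, le_rfl⟩
    · obtain ⟨hmem, heq⟩ := hunit y hy v hv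
      have hle := hmin hmem
      have hge := hmax hmem
      simp only [mem_setOf_eq] at hle hge
      rw [heq]
      constructor
      · rw [mul_comm]
        exact mul_le_mul_of_nonneg_left hle (sq_nonneg _)
      · rw [mul_comm (max _ _)]
        exact mul_le_mul_of_nonneg_left (hge.trans (le_max_left _ _)) (sq_nonneg _)

end MetricContinuity

/-! #### The differential of a function on the end: bridge to `fderiv` -/

section Differential

variable (τ : D.U → ℝ)

/-- The extension by zero of `τ : U → ℝ` to `E` restricts to `τ`. [folklore] -/
theorem extend_val_apply (x : D.U) :
    Function.extend (Subtype.val : D.U → E) τ 0 (x : E) = τ x :=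
  Subtype.val_injective.extend_apply _ _ x

/-- The end, seen in `E`, is open. [folklore] -/
theorem isOpen_image_compl :
    IsOpen ((Subtype.val : D.U → E) '' (⋂ k, range (D.σ^[k]))ᶜ) :=
  D.U.2.isOpenMap_subtype_val _ D.isOpen_compl_iInter

/-- A function `C^∞` on the end (as a function on the manifold `U`) extends by zero to a
function on `E` which is `C^∞` on the end seen in `E`. [folklore] -/
theorem contDiffOn_extend (hτ : ContMDiffOn 𝓘(ℝ, E) 𝓘(ℝ) ∞ τ (⋂ k, range (D.σ^[k]))ᶜ) :
    ContDiffOn ℝ ∞ (Function.extend (Subtype.val : D.U → E) τ 0)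
      ((Subtype.val : D.U → E) '' (⋂ k, range (D.σ^[k]))ᶜ) := by
  rintro _ ⟨x, hx, rfl⟩
  have h1 : ContMDiffAt 𝓘(ℝ, E) 𝓘(ℝ) ∞ τ x :=
    (hτ x hx).contMDiffAt (D.isOpen_compl_iInter.mem_nhds hx)
  have h2 : ContMDiffAt 𝓘(ℝ, E) 𝓘(ℝ) ∞
      (fun z : D.U => Function.extend (Subtype.val : D.U → E) τ 0 (z : E)) x := by
    have heq : (fun z : D.U => Function.extend (Subtype.val : D.U → E) τ 0 (z : E)) = τ :=
      funext (D.extend_val_apply τ)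
    rw [heq]
    exact h1
  exact (contMDiffAt_iff_contDiffAt.1 (contMDiffAt_subtype_iff.1 h2)).contDiffWithinAt

/-- `τ` restricted to the end is `C^∞` (for the open-submanifold structure of the end).
[folklore] -/
theorem contMDiff_restrict_end (hτ : ContMDiffOn 𝓘(ℝ, E) 𝓘(ℝ) ∞ τ (⋂ k, range (D.σ^[k]))ᶜ) :
    ContMDiff 𝓘(ℝ, E) 𝓘(ℝ) ∞ (fun z : D.End => τ z) :=
  hτ.comp_contMDiff contMDiff_subtype_val fun z => z.2

/-- **The differential of `τ` on the end is the Fréchet derivative of its extension to `E`** (the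
inclusion of the end in `E` has identity differential, `OpenSubmanifold.hasMFDerivAt_subtype_val`).
[folklore] -/
theorem hasMFDerivAt_restrict_end (hτ : ContMDiffOn 𝓘(ℝ, E) 𝓘(ℝ) ∞ τ (⋂ k, range (D.σ^[k]))ᶜ)
    (y : D.End) :
    HasMFDerivAt 𝓘(ℝ, E) 𝓘(ℝ) (fun z : D.End => τ z) y
      (fderiv ℝ (Function.extend (Subtype.val : D.U → E) τ 0) ((y : D.U) : E)) := by
  have hy : ((y : D.U) : E) ∈ (Subtype.val : D.U → E) '' (⋂ k, range (D.σ^[k]))ᶜ := ⟨y, y.2, rfl⟩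
  have hd : DifferentiableAt ℝ (Function.extend (Subtype.val : D.U → E) τ 0) ((y : D.U) : E) :=
    ((D.contDiffOn_extend τ hτ).differentiableOn (by simp)).differentiableAt
      (D.isOpen_image_compl.mem_nhds hy)
  have h3 : HasMFDerivAt 𝓘(ℝ, E) 𝓘(ℝ) (Function.extend (Subtype.val : D.U → E) τ 0) ((y : D.U) : E)
      (fderiv ℝ (Function.extend (Subtype.val : D.U → E) τ 0) ((y : D.U) : E)) :=
    hasMFDerivAt_iff_hasFDerivAt.2 hd.hasFDerivAt
  have h1 : HasMFDerivAt 𝓘(ℝ, E) 𝓘(ℝ, E) (Subtype.val : D.End → D.U) y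
      (ContinuousLinearMap.id ℝ E) :=
    OpenSubmanifold.hasMFDerivAt_subtype_val y
  have h2 : HasMFDerivAt 𝓘(ℝ, E) 𝓘(ℝ, E) (Subtype.val : D.U → E) (y : D.U)
      (ContinuousLinearMap.id ℝ E) :=
    OpenSubmanifold.hasMFDerivAt_subtype_val (y : D.U)
  have h := (h3.comp y (h2.comp y h1)).congr_mfderiv
    (f₁' := fderiv ℝ (Function.extend (Subtype.val : D.U → E) τ 0) ((y : D.U) : E))
    (by ext v; rfl)
  have heq : Function.extend (Subtype.val : D.U → E) τ 0 ∘ (Subtype.val : D.U → E) ∘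
      (Subtype.val : D.End → D.U) = fun z : D.End => τ z :=
    funext fun z => D.extend_val_apply τ z
  rwa [heq] at h

/-- The differential of `τ` on the end equals the Fréchet derivative of its extension.
[folklore] -/
theorem dEnd_eq_fderiv (hτ : ContMDiffOn 𝓘(ℝ, E) 𝓘(ℝ) ∞ τ (⋂ k, range (D.σ^[k]))ᶜ) (y : D.End) :
    D.dEnd τ y = fderiv ℝ (Function.extend (Subtype.val : D.U → E) τ 0) ((y : D.U) : E) :=
  (D.hasMFDerivAt_restrict_end τ hτ y).mfderiv

/-- **The differential `y ↦ dτ_y` is continuous on the end** (as a map into `E →L ℝ`).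
[folklore] -/
theorem continuous_dEnd (hτ : ContMDiffOn 𝓘(ℝ, E) 𝓘(ℝ) ∞ τ (⋂ k, range (D.σ^[k]))ᶜ) :
    Continuous fun y : D.End => D.dEnd τ y := by
  have hcont : ContinuousOn (fun x => fderiv ℝ (Function.extend (Subtype.val : D.U → E) τ 0) x)
      ((Subtype.val : D.U → E) '' (⋂ k, range (D.σ^[k]))ᶜ) :=
    (D.contDiffOn_extend τ hτ).continuousOn_fderiv_of_isOpen D.isOpen_image_compl (by simp)
  have hι : Continuous fun y : D.End => ((y : D.U) : E) :=
    continuous_subtype_val.comp continuous_subtype_val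
  have h := hcont.comp_continuous hι fun y => ⟨y, y.2, rfl⟩
  exact h.congr fun y => (D.dEnd_eq_fderiv τ hτ y).symm

/-- The points of the iterated deck transformation are the iterates of `σ`. [folklore] -/
theorem coe_deck_iterate : ∀ (j : ℕ) (y : D.End), ((D.deck^[j] y : D.End) : D.U) = D.σ^[j] (y : D.U)
  | 0, _ => rfl
  | j + 1, y => by
    rw [Function.iterate_succ_apply', Function.iterate_succ_apply', coe_deck, coe_deck_iterate j y]

/-- The shift law along the iterated deck transformation: `τ (σ^[j] y) = τ y + j`.
[cite: DeMichelisFreedman1992, §2 (p. 223)] -/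
theorem apply_deck_iterate (hshift : ∀ x, x ∉ (⋂ k, range (D.σ^[k])) → τ (D.σ x) = τ x + 1)
    (j : ℕ) (y : D.End) : τ (D.deck^[j] y : D.End) = τ y + j := by
  rw [coe_deck_iterate]
  exact apply_iterate_eq_add_of_shift D.isOpenEmbedding_σ.injective hshift j (y : D.U) y.2

end Differential

/-! #### The compact set `C ∖ σ²(U)` meets every orbit of the deck transformation -/

section FundamentalSet

/-- **The set `C ∖ σ²(U)` is a compact subset of the end** (it contains the fundamental domain
`C ∖ σ(C)` and misses the end compactum). [cite: DeMichelisFreedman1992, §2 (p. 223)] -/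
theorem isCompact_fundamentalSet :
    IsCompact {y : D.End | (y : D.U) ∈ D.C \ range (D.σ^[2])} := by
  have hsub : D.C \ range (D.σ^[2]) ⊆ (⋂ k, range (D.σ^[k]))ᶜ :=
    diff_range_iterate_two_subset_compl D.C D.σ
  have hK : IsCompact (D.C \ range (D.σ^[2])) :=
    isCompact_diff_range_iterate_two D.isOpenEmbedding_σ D.hC
  rw [Topology.IsEmbedding.subtypeVal.isCompact_iff]
  convert hK using 1
  ext x
  constructor
  · rintro ⟨y, hy, rfl⟩
    exact hy
  · intro hx
    exact ⟨⟨x, hsub hx⟩, hx, rfl⟩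

/-- **Every orbit of the deck transformation meets `C ∖ σ²(U)`**: every point `y` of the end is
`σ^[j] x` for some `x ∈ C ∖ σ²(U)`, or some `x ∈ C ∖ σ²(U)` is `σ^[j] y` (the fundamental domain
`C ∖ σ(C) ⊆ C ∖ σ²(U)` meets every orbit, `existsUnique_mem_diff_image`).
[cite: DeMichelisFreedman1992, §2 (p. 223)] -/
theorem exists_mem_fundamentalSet_rel (y : D.End) :
    ∃ x : D.End, (x : D.U) ∈ D.C \ range (D.σ^[2]) ∧
      ((∃ j : ℕ, y = D.deck^[j] x) ∨ ∃ j : ℕ, x = D.deck^[j] y) := by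
  have hinj := D.isOpenEmbedding_σ.injective
  obtain ⟨x₀, ⟨hx₀, m, n, hmn⟩, -⟩ := existsUnique_mem_diff_image hinj D.hσC (x := (y : D.U)) y.2
  have hx₀F : x₀ ∈ D.C \ range (D.σ^[2]) := diff_image_subset_diff_range_iterate_two D.hσC hx₀
  have hx₀E : x₀ ∈ (⋂ k, range (D.σ^[k]))ᶜ := diff_range_iterate_two_subset_compl D.C D.σ hx₀F
  refine ⟨⟨x₀, hx₀E⟩, hx₀F, ?_⟩
  have hrel : orbitProj D.σ y = orbitProj D.σ (⟨x₀, hx₀E⟩ : D.End) := Quotient.sound ⟨m, n, hmn⟩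
  rcases (mk_eq_mk_iff hinj).1 hrel with ⟨j, hj⟩ | ⟨j, hj⟩
  · refine Or.inl ⟨j, Subtype.ext ?_⟩
    rw [coe_deck_iterate]
    exact hj
  · refine Or.inr ⟨j, Subtype.ext ?_⟩
    rw [coe_deck_iterate]
    exact hj

end FundamentalSet

/-! #### `|grad τ|_g` is invariant under the deck transformation -/

section Deck

variable [FiniteDimensional ℝ E]
  (g : PseudoRiemannianMetric 𝓘(ℝ, E) ∞ E (TangentSpace 𝓘(ℝ, E) : D.End → Type _)) (τ : D.U → ℝ)

omit [FiniteDimensional ℝ E] in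
/-- **`d(τ ∘ σ) = dτ`**: `dτ_{σ y} ∘ dσ_y = dτ_y` for a function with `τ ∘ σ = τ + 1` on the end.
[cite: DeMichelisFreedman1992, §2 (p. 223)] -/
theorem dEnd_deck_comp (hτ : ContMDiffOn 𝓘(ℝ, E) 𝓘(ℝ) ∞ τ (⋂ k, range (D.σ^[k]))ᶜ)
    (hshift : ∀ x, x ∉ (⋂ k, range (D.σ^[k])) → τ (D.σ x) = τ x + 1) (y : D.End) :
    (D.dEnd τ (D.deck y)).comp (mfderiv 𝓘(ℝ, E) 𝓘(ℝ, E) D.deck y) = D.dEnd τ y := by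
  have hf : ContMDiff 𝓘(ℝ, E) 𝓘(ℝ) ∞ (fun z : D.End => τ z) := D.contMDiff_restrict_end τ hτ
  have h1 : HasMFDerivAt 𝓘(ℝ, E) 𝓘(ℝ) ((fun z : D.End => τ z) ∘ D.deck) y
      ((D.dEnd τ (D.deck y)).comp (mfderiv 𝓘(ℝ, E) 𝓘(ℝ, E) D.deck y)) :=
    ((hf (D.deck y)).mdifferentiableAt (by simp)).hasMFDerivAt.comp y
      ((D.contMDiff_deck y).mdifferentiableAt (by simp)).hasMFDerivAt
  have h2 := ((hf y).mdifferentiableAt (by simp)).hasMFDerivAt.add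
    (hasMFDerivAt_const (I := 𝓘(ℝ, E)) (I' := 𝓘(ℝ)) (1 : ℝ) y)
  have heq : (fun z : D.End => τ z) ∘ D.deck = ((fun z : D.End => τ z) + fun _ : D.End => (1 : ℝ)) :=
    funext fun z => hshift (z : D.U) z.2
  rw [heq] at h1
  exact (hasMFDerivAt_unique h1 h2).trans (add_zero _)

/-- **`|grad τ|_g` is invariant under the deck transformation** when `g` is (`σ^* g = g`: the
deck transformation is an isometry of the periodic metric, `pullbackBilin_deck_coverMetric`) and
`τ ∘ σ = τ + 1`: `dτ_y = dτ_{σ y} ∘ dσ_y`, `g_y = dσ_y^* g_{σ y}`, and `dσ_y` is a linear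
isomorphism, so `♯_{σ y} dτ_{σ y} = dσ_y (♯_y dτ_y)` and `|grad τ|² (σ y) = |grad τ|² (y)`.
[cite: DeMichelisFreedman1992, §2 (p. 223), App. B (p. 251)] -/
theorem gradNormSq_deck (hR : g.IsRiemannian)
    (hg : ∀ y, pullbackBilin (I := 𝓘(ℝ, E)) (I' := 𝓘(ℝ, E)) D.deck g.val y = g.val y)
    (hτ : ContMDiffOn 𝓘(ℝ, E) 𝓘(ℝ) ∞ τ (⋂ k, range (D.σ^[k]))ᶜ)
    (hshift : ∀ x, x ∉ (⋂ k, range (D.σ^[k])) → τ (D.σ x) = τ x + 1) (y : D.End) :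
    D.gradNormSq g τ (D.deck y) = D.gradNormSq g τ y := by
  -- the differential of the deck transformation at `y`, as an endomorphism of `E`
  obtain ⟨A, hA⟩ : ∃ A : E →L[ℝ] E, A = mfderiv 𝓘(ℝ, E) 𝓘(ℝ, E) D.deck y := ⟨_, rfl⟩
  have hcomp : ∀ v : E, D.dEnd τ (D.deck y) (A v) = D.dEnd τ y v := fun v => by
    have h := DFunLike.congr_fun (D.dEnd_deck_comp τ hτ hshift y) v
    rw [← hA] at h
    exact h
  have hiso : ∀ v w : E, D.valE g (D.deck y) (A v) (A w) = D.valE g y v w := fun v w => by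
    have h := DFunLike.congr_fun (DFunLike.congr_fun (hg y) v) w
    rw [hA]
    exact h
  -- `A` is injective (it is an isometry of inner products), hence surjective
  have hAinj : Function.Injective A := by
    intro v w hvw
    by_contra hne
    have hpos : 0 < D.valE g y (v - w) (v - w) := hR y (v - w) (sub_ne_zero.2 hne)
    rw [← hiso (v - w) (v - w), map_sub, hvw, sub_self] at hpos
    simp only [map_zero] at hpos
    exact lt_irrefl _ hpos
  have hAsurj : Function.Surjective A := by
    have h : Function.Surjective (A : E →ₗ[ℝ] E) := LinearMap.surjective_of_injective hAinj
    exact h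
  -- transport of `♯`
  set α' : E →ₗ[ℝ] ℝ := (D.dEnd τ (D.deck y) : E →ₗ[ℝ] ℝ) with hα'
  set α : E →ₗ[ℝ] ℝ := (D.dEnd τ y : E →ₗ[ℝ] ℝ) with hα
  have hcomp' : ∀ v : E, α' (A v) = α v := hcomp
  have hsharp : (g.sharp (D.deck y) α' : E) = A (g.sharp y α) := by
    apply g.flat_injective (D.deck y)
    apply LinearMap.ext
    intro w'
    obtain ⟨w, rfl⟩ := hAsurj w'
    rw [flat_apply, flat_apply, val_sharp_apply]
    change α' (A w) = D.valE g (D.deck y) (A (g.sharp y α)) (A w)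
    rw [hiso, hcomp']
    exact (val_sharp_apply g y α w).symm
  change α' (g.sharp (D.deck y) α') = α (g.sharp y α)
  rw [hsharp, hcomp']

/-- `|grad τ|_g` is invariant under the iterated deck transformation. [folklore] -/
theorem gradNormSq_deck_iterate (hR : g.IsRiemannian)
    (hg : ∀ y, pullbackBilin (I := 𝓘(ℝ, E)) (I' := 𝓘(ℝ, E)) D.deck g.val y = g.val y)
    (hτ : ContMDiffOn 𝓘(ℝ, E) 𝓘(ℝ) ∞ τ (⋂ k, range (D.σ^[k]))ᶜ)
    (hshift : ∀ x, x ∉ (⋂ k, range (D.σ^[k])) → τ (D.σ x) = τ x + 1) :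
    ∀ (j : ℕ) (y : D.End), D.gradNormSq g τ (D.deck^[j] y) = D.gradNormSq g τ y
  | 0, _ => rfl
  | j + 1, y => by
    rw [Function.iterate_succ_apply', D.gradNormSq_deck g τ hR hg hτ hshift,
      gradNormSq_deck_iterate hR hg hτ hshift j y]

/-- The critical set of `τ` on the end is invariant under the deck transformation: `dτ_{σ y} = 0`
iff `dτ_y = 0`. [folklore] -/
theorem dEnd_deck_eq_zero_iff (hR : g.IsRiemannian)
    (hg : ∀ y, pullbackBilin (I := 𝓘(ℝ, E)) (I' := 𝓘(ℝ, E)) D.deck g.val y = g.val y)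
    (hτ : ContMDiffOn 𝓘(ℝ, E) 𝓘(ℝ) ∞ τ (⋂ k, range (D.σ^[k]))ᶜ)
    (hshift : ∀ x, x ∉ (⋂ k, range (D.σ^[k])) → τ (D.σ x) = τ x + 1) (y : D.End) :
    D.dEnd τ (D.deck y) = 0 ↔ D.dEnd τ y = 0 := by
  obtain ⟨A, hA⟩ : ∃ A : E →L[ℝ] E, A = mfderiv 𝓘(ℝ, E) 𝓘(ℝ, E) D.deck y := ⟨_, rfl⟩
  have hcompA : (D.dEnd τ (D.deck y)).comp A = D.dEnd τ y := by
    rw [hA]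
    exact D.dEnd_deck_comp τ hτ hshift y
  have hiso : ∀ v w : E, D.valE g (D.deck y) (A v) (A w) = D.valE g y v w := fun v w => by
    have h := DFunLike.congr_fun (DFunLike.congr_fun (hg y) v) w
    rw [hA]
    exact h
  have hAinj : Function.Injective A := by
    intro v w hvw
    by_contra hne
    have hpos : 0 < D.valE g y (v - w) (v - w) := hR y (v - w) (sub_ne_zero.2 hne)
    rw [← hiso (v - w) (v - w), map_sub, hvw, sub_self] at hpos
    simp only [map_zero] at hpos
    exact lt_irrefl _ hpos
  have hAsurj : Function.Surjective A := by
    have h : Function.Surjective (A : E →ₗ[ℝ] E) := LinearMap.surjective_of_injective hAinj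
    exact h
  constructor
  · intro h
    rw [← hcompA, h, ContinuousLinearMap.zero_comp]
  · intro h
    ext w'
    obtain ⟨w, rfl⟩ := hAsurj w'
    have := DFunLike.congr_fun hcompA w
    rw [ContinuousLinearMap.comp_apply, h] at this
    rw [this]
    rfl

/-- The critical set is invariant under the iterated deck transformation. [folklore] -/
theorem dEnd_deck_iterate_eq_zero_iff (hR : g.IsRiemannian)
    (hg : ∀ y, pullbackBilin (I := 𝓘(ℝ, E)) (I' := 𝓘(ℝ, E)) D.deck g.val y = g.val y)
    (hτ : ContMDiffOn 𝓘(ℝ, E) 𝓘(ℝ) ∞ τ (⋂ k, range (D.σ^[k]))ᶜ)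
    (hshift : ∀ x, x ∉ (⋂ k, range (D.σ^[k])) → τ (D.σ x) = τ x + 1) :
    ∀ (j : ℕ) (y : D.End), D.dEnd τ (D.deck^[j] y) = 0 ↔ D.dEnd τ y = 0
  | 0, _ => Iff.rfl
  | j + 1, y => by
    rw [Function.iterate_succ_apply', D.dEnd_deck_eq_zero_iff g τ hR hg hτ hshift,
      dEnd_deck_iterate_eq_zero_iff hR hg hτ hshift j y]

end Deck

/-! #### Hypothesis (1): the link of the fundamental domain and its iterates in the segments -/

section Link

/-- **The link `L = C ∖ σ(U)`** of the fundamental domain is compact (`C` compact, `σ(U)` open).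
[cite: DeMichelisFreedman1992, §2 (p. 223)] -/
theorem isCompact_link : IsCompact (D.C \ range D.σ) :=
  D.hC.diff D.isOpenEmbedding_σ.isOpen_range

/-- The iterates of the link: `σ^[k](L) = σ^[k](C) ∖ σ^[k+1](U)`. [folklore] -/
theorem image_iterate_link (k : ℕ) :
    D.σ^[k] '' (D.C \ range D.σ) = D.σ^[k] '' D.C \ range (D.σ^[k + 1]) := by
  rw [image_sdiff (D.isOpenEmbedding_σ.injective.iterate k), ← range_iterate_succ_eq]

/-- **The iterates of the link lie in the segments `{k ≤ τ ≤ k + 1}`** of any height function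
with the ring bounds of `exists_smooth_height_function` (`k ≤ τ` on `σ^[k](U)` off the end
compactum, `τ ≤ k` off `σ^[k](U)`): "a topological … 3-sphere lies in each segment
`τ⁻¹[i, i + 1]`". [cite: DeMichelisFreedman1992, App. B (p. 251)] -/
theorem height_mem_Icc_of_mem_image_iterate_link {τ : D.U → ℝ}
    (hlower : ∀ (k : ℕ) (x : D.U), x ∉ (⋂ k, range (D.σ^[k])) → x ∈ range (D.σ^[k]) →
      (k : ℝ) ≤ τ x)
    (hupper : ∀ (k : ℕ) (x : D.U), x ∉ range (D.σ^[k]) → τ x ≤ k)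
    (k : ℕ) {x : D.U} (hx : x ∈ D.σ^[k] '' (D.C \ range D.σ)) :
    (k : ℝ) ≤ τ x ∧ τ x ≤ k + 1 := by
  rw [image_iterate_link] at hx
  obtain ⟨hxC, hxr⟩ := hx
  have hxk : x ∈ range (D.σ^[k]) := image_subset_range _ _ hxC
  have hxK : x ∉ ⋂ j, range (D.σ^[j]) := fun h => hxr (mem_iInter.1 h (k + 1))
  refine ⟨hlower k x hxK hxk, ?_⟩
  have h := hupper (k + 1) x hxr
  push_cast at h
  exact h

/-- **The iterated link separates `U`**: the complement of `σ^[k](L)` is the disjoint union of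
the open "end side" `σ^[k+1](U)` (which contains the end compactum) and the open "outside"
`U ∖ σ^[k](C)` — the sense in which the sphere is a "factor" of the end `≅ S³ × ℝ`.
[cite: DeMichelisFreedman1992, App. B (p. 251)] -/
theorem compl_image_iterate_link (k : ℕ) :
    (D.σ^[k] '' (D.C \ range D.σ))ᶜ = range (D.σ^[k + 1]) ∪ (D.σ^[k] '' D.C)ᶜ ∧
      IsOpen (range (D.σ^[k + 1])) ∧ IsOpen (D.σ^[k] '' D.C)ᶜ ∧
      Disjoint (range (D.σ^[k + 1])) (D.σ^[k] '' D.C)ᶜ ∧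
      (⋂ j, range (D.σ^[j])) ⊆ range (D.σ^[k + 1]) := by
  refine ⟨?_, (isOpenEmbedding_iterate D.isOpenEmbedding_σ (k + 1)).isOpen_range,
    (D.hC.image (D.isOpenEmbedding_σ.continuous.iterate k)).isClosed.isOpen_compl,
    disjoint_compl_right_iff_subset.2 (range_iterate_succ_subset_image D.hσC k),
    iInter_subset _ (k + 1)⟩
  rw [image_iterate_link]
  ext x
  simp only [mem_compl_iff, Set.mem_sdiff, mem_union, not_and, not_not]
  tauto

end Link

end General

/-! ### Hypothesis (2) of Appendix B: `0 < b < |grad τ|_g < c` off `τ⁻¹(Δ)`, `Δ` small -/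

section GradientBounds

variable {E : Type} [NormedAddCommGroup E] [NormedSpace ℝ E] [FiniteDimensional ℝ E]
  (D : EndPeriodicData E)

/-- **Sard's theorem for `τ` on the end**: the critical values of `τ` — the heights of the points
of the end where `dτ = 0` — form a Lebesgue-null set (the critical values of the extension of
`τ` to the open subset of `E` under the end,
`Literature.Analysis.Calculus.measure_image_setOf_not_surjective_fderiv_eq_zero`).
[cite: Sard1942, Thms. 4.1, 7.2] -/
theorem volume_image_setOf_dEnd_eq_zero (τ : D.U → ℝ)
    (hτ : ContMDiffOn 𝓘(ℝ, E) 𝓘(ℝ) ∞ τ (⋂ k, range (D.σ^[k]))ᶜ) :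
    volume ((fun y : D.End => τ y) '' {y : D.End | D.dEnd τ y = 0}) = 0 := by
  have hsard := Literature.Analysis.Calculus.measure_image_setOf_not_surjective_fderiv_eq_zero
    (volume : Measure ℝ) D.isOpen_image_compl (D.contDiffOn_extend τ hτ)
  refine measure_mono_null ?_ hsard
  rintro _ ⟨y, hy, rfl⟩
  refine ⟨((y : D.U) : E), ⟨⟨y, y.2, rfl⟩, ?_⟩, D.extend_val_apply τ y⟩
  have hy0 : D.dEnd τ y = 0 := hy
  rw [← D.dEnd_eq_fderiv τ hτ y, hy0]
  intro hsurj
  obtain ⟨v, hv⟩ := hsurj 1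
  simp at hv

/-- **Hypothesis (2) of Appendix B (DeMichelis–Freedman 1992, p. 251) holds for the end-periodic
end.** Let `g` be a Riemannian metric on the end `U ∖ ⋂ₖ σ^[k](U)` invariant under the deck
transformation (`σ^* g = g`; e.g. the pulled-back metric `π^* g_Y`, `pullbackBilin_deck_coverMetric`)
and `τ` a function `C^∞` on the end with `τ ∘ σ = τ + 1` there (Taubes' height function,
`exists_smooth_height_function`). Then "there exist constants `0 < b < c` and a closed subset
`Δ` such that `b < |grad τ(x)| < c` for `x ∈ τ⁻¹(ℝ − Δ)` and where the measure of `Δ`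
intersected with any interval of length one is smaller than `½`": here `|grad τ|_g = √(g⁻¹(dτ, dτ))`
(`gradNormSq`), the upper bound holds everywhere, and `Δ ⊆ ℝ` (the source intersects with
`[0, ∞)`). Proof: `|grad τ|_g` and the critical set are invariant under `σ` (`gradNormSq_deck`,
`dEnd_deck_eq_zero_iff`), every orbit meets the compact `C ∖ σ²(U)` (`exists_mem_fundamentalSet_rel`)
where `g` is uniformly equivalent to the norm of `E` (`exists_uniform_bounds`) and `dτ` is bounded,
and bounded away from `0` off a neighbourhood of the critical set; the critical values there form a
compact null set `V` by Sard's theorem (`volume_image_setOf_dEnd_eq_zero`), all critical values lie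
in `V + ℤ` (`τ ∘ σ = τ + 1`), and `Δ = ⋃_{k ∈ ℤ} (k + Δ₁)` for a compact `δ`-neighbourhood `Δ₁` of
`V` of measure `< 1 / (2 (w + 8))`, `w` the oscillation of `τ` on `C ∖ σ²(U)`, `δ ≤ 1`, so that
`Δ` is closed (a locally finite union) and meets each `[a, a + 1]` in at most `w + 4` translates
of `Δ₁`. [cite: DeMichelisFreedman1992, App. B (p. 251)] -/
theorem exists_gradient_bounds
    (g : PseudoRiemannianMetric 𝓘(ℝ, E) ∞ E (TangentSpace 𝓘(ℝ, E) : D.End → Type _))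
    (hR : g.IsRiemannian)
    (hg : ∀ y, pullbackBilin (I := 𝓘(ℝ, E)) (I' := 𝓘(ℝ, E)) D.deck g.val y = g.val y)
    (τ : D.U → ℝ) (hτ : ContMDiffOn 𝓘(ℝ, E) 𝓘(ℝ) ∞ τ (⋂ k, range (D.σ^[k]))ᶜ)
    (hshift : ∀ x, x ∉ (⋂ k, range (D.σ^[k])) → τ (D.σ x) = τ x + 1) :
    ∃ b c : ℝ, 0 < b ∧ b < c ∧ ∃ Δ : Set ℝ, IsClosed Δ ∧
      (∀ a : ℝ, volume (Δ ∩ Icc a (a + 1)) < ENNReal.ofReal (1 / 2)) ∧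
      (∀ y : D.End, Real.sqrt (D.gradNormSq g τ y) < c) ∧
      (∀ y : D.End, τ y ∉ Δ → b < Real.sqrt (D.gradNormSq g τ y)) := by
  classical
  -- the compact set `F = C ∖ σ²(U)` and the players restricted to the end
  obtain ⟨F, hF⟩ : ∃ F : Set D.End, F = {y : D.End | (y : D.U) ∈ D.C \ range (D.σ^[2])} :=
    ⟨_, rfl⟩
  have hFc : IsCompact F := hF ▸ D.isCompact_fundamentalSet
  obtain ⟨f, hf⟩ : ∃ f : D.End → ℝ, f = fun y : D.End => τ y := ⟨_, rfl⟩
  have hfc : Continuous f := hf ▸ (D.contMDiff_restrict_end τ hτ).continuous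
  have hfy : ∀ y, f y = τ y := fun y => by rw [hf]
  obtain ⟨N, hN⟩ : ∃ N : D.End → ℝ, N = fun y => D.gradNormSq g τ y := ⟨_, rfl⟩
  have hNy : ∀ y, N y = D.gradNormSq g τ y := fun y => by rw [hN]
  have hℓc : Continuous fun y : D.End => D.dEnd τ y := D.continuous_dEnd τ hτ
  -- reduction to `F` along the orbits of the deck transformation
  have hrel : ∀ y : D.End, ∃ x ∈ F, N y = N x ∧ (D.dEnd τ y = 0 ↔ D.dEnd τ x = 0) ∧
      ∃ k : ℤ, f y = f x + k := by
    intro y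
    obtain ⟨x, hxF, hxy⟩ := D.exists_mem_fundamentalSet_rel y
    refine ⟨x, hF ▸ hxF, ?_⟩
    rcases hxy with ⟨j, rfl⟩ | ⟨j, rfl⟩
    · refine ⟨?_, D.dEnd_deck_iterate_eq_zero_iff g τ hR hg hτ hshift j x, j, ?_⟩
      · rw [hNy, hNy]
        exact D.gradNormSq_deck_iterate g τ hR hg hτ hshift j x
      · rw [hfy, hfy, D.apply_deck_iterate τ hshift j x]
        push_cast
        ring
    · refine ⟨?_, (D.dEnd_deck_iterate_eq_zero_iff g τ hR hg hτ hshift j y).symm, -(j : ℤ), ?_⟩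
      · rw [hNy, hNy]
        exact (D.gradNormSq_deck_iterate g τ hR hg hτ hshift j y).symm
      · rw [hfy, hfy, D.apply_deck_iterate τ hshift j y]
        push_cast
        ring
  -- uniform comparison of `g` with the norm of `E` on `F`, bound on `dτ` there
  obtain ⟨m, M, hm, hM, hmM⟩ := D.exists_uniform_bounds g hR hFc
  have hnc : Continuous fun y : D.End => ‖D.dEnd τ y‖ := hℓc.norm
  obtain ⟨L, hL⟩ := hFc.bddAbove_image hnc.continuousOn
  have hL' : ∀ x ∈ F, ‖D.dEnd τ x‖ ≤ L := fun x hx => hL ⟨x, hx, rfl⟩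
  -- (i) the global upper bound
  obtain ⟨c, hc⟩ : ∃ c : ℝ, c = Real.sqrt (L ^ 2 / m) + 1 := ⟨_, rfl⟩
  have hNF : ∀ x ∈ F, N x ≤ L ^ 2 / m := fun x hx => by
    have h1 := innerDual_le_of_lower g x hm (fun v => (hmM x hx v).1) (D.dEnd τ x)
    have h2 : ‖D.dEnd τ x‖ ^ 2 ≤ L ^ 2 := by
      have h0 : 0 ≤ ‖D.dEnd τ x‖ := norm_nonneg _
      have := hL' x hx
      nlinarith
    rw [hNy]
    exact h1.trans (div_le_div_of_nonneg_right h2 hm.le)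
  have hupper : ∀ y : D.End, Real.sqrt (N y) < c := fun y => by
    obtain ⟨x, hxF, hNx, -, -⟩ := hrel y
    rw [hNx, hc]
    exact (Real.sqrt_le_sqrt (hNF x hxF)).trans_lt (lt_add_one _)
  have hc0 : 0 < c := by rw [hc]; positivity
  -- (ii) the critical values on `F`: a compact null set of heights
  obtain ⟨V, hV⟩ : ∃ V : Set ℝ, V = f '' {x ∈ F | D.dEnd τ x = 0} := ⟨_, rfl⟩
  have hVc : IsCompact V := hV ▸ (hFc.inter_right (isClosed_eq hℓc continuous_const)).image hfc
  have hV0 : volume V = 0 := by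
    rw [hV, hf]
    exact measure_mono_null (image_mono fun x hx => hx.2) (D.volume_image_setOf_dEnd_eq_zero τ hτ)
  -- the heights of `F` lie in `[a₀, b₀]`
  obtain ⟨a₀, ha₀⟩ := hFc.bddBelow_image hfc.continuousOn
  obtain ⟨b₀, hb₀⟩ := hFc.bddAbove_image hfc.continuousOn
  obtain ⟨w, hw⟩ : ∃ w : ℝ, w = max (b₀ - a₀) 0 := ⟨_, rfl⟩
  have hw0 : 0 ≤ w := hw ▸ le_max_right _ _
  have hwba : b₀ - a₀ ≤ w := hw ▸ le_max_left _ _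
  obtain ⟨ε, hε⟩ : ∃ ε : ℝ, ε = 1 / (2 * (w + 8)) := ⟨_, rfl⟩
  have hε0 : 0 < ε := by rw [hε]; positivity
  -- a compact neighbourhood `Δ₁` of `V` of measure `< ε`, within distance `δ ≤ 1` of `V`
  obtain ⟨O, hVO, hO, hOε⟩ := V.exists_isOpen_lt_of_lt (ENNReal.ofReal ε)
    (by rw [hV0]; exact ENNReal.ofReal_pos.2 hε0)
  obtain ⟨δ₀, hδ₀, hδ₀O⟩ := hVc.exists_cthickening_subset_open hO hVO
  obtain ⟨δ, hδ⟩ : ∃ δ : ℝ, δ = min δ₀ 1 := ⟨_, rfl⟩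
  have hδpos : 0 < δ := hδ ▸ lt_min hδ₀ one_pos
  have hδ1 : δ ≤ 1 := hδ ▸ min_le_right _ _
  obtain ⟨Δ₁, hΔ₁⟩ : ∃ Δ₁ : Set ℝ, Δ₁ = cthickening δ V := ⟨_, rfl⟩
  have hΔ₁c : IsClosed Δ₁ := hΔ₁ ▸ isClosed_cthickening
  have hΔ₁ε : volume Δ₁ < ENNReal.ofReal ε := by
    refine (measure_mono ?_).trans_lt hOε
    rw [hΔ₁]
    exact (cthickening_mono (hδ ▸ min_le_left _ _) V).trans hδ₀O
  have hthΔ₁ : thickening δ V ⊆ Δ₁ := hΔ₁ ▸ thickening_subset_cthickening δ V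
  have hVth : V ⊆ thickening δ V := self_subset_thickening hδpos V
  have hΔ₁bd : ∀ r ∈ Δ₁, a₀ - 1 ≤ r ∧ r ≤ b₀ + 1 := by
    intro r hr
    rw [hΔ₁, hVc.cthickening_eq_biUnion_closedBall hδpos.le] at hr
    obtain ⟨v, hv, hrv⟩ := mem_iUnion₂.1 hr
    rw [hV] at hv
    obtain ⟨x, hx, rfl⟩ := hv
    have h1 : a₀ ≤ f x := ha₀ ⟨x, hx.1, rfl⟩
    have h2 : f x ≤ b₀ := hb₀ ⟨x, hx.1, rfl⟩
    rw [mem_closedBall, Real.dist_eq] at hrv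
    obtain ⟨h3, h4⟩ := abs_le.1 hrv
    constructor <;> linarith
  -- the closed set `Δ = ⋃_{k ∈ ℤ} (Δ₁ - k)`
  obtain ⟨Δ, hΔ⟩ : ∃ Δ : Set ℝ, Δ = ⋃ k : ℤ, (fun r : ℝ => (k : ℝ) + r) ⁻¹' Δ₁ := ⟨_, rfl⟩
  have hmemΔ : ∀ r, r ∈ Δ ↔ ∃ k : ℤ, (k : ℝ) + r ∈ Δ₁ := fun r => by
    rw [hΔ, mem_iUnion]
    rfl
  have hΔc : IsClosed Δ := by
    rw [hΔ]
    refine LocallyFinite.isClosed_iUnion (fun r => ?_) fun k =>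
      hΔ₁c.preimage (continuous_const.add continuous_id)
    refine ⟨Ioo (r - 1) (r + 1), Ioo_mem_nhds (by linarith) (by linarith), ?_⟩
    refine (Set.finite_Icc (⌊a₀ - r - 3⌋) (⌈b₀ - r + 3⌉)).subset ?_
    rintro k ⟨r', hr'k, hr'⟩
    obtain ⟨h1, h2⟩ := hΔ₁bd _ hr'k
    obtain ⟨h3, h4⟩ := hr'
    refine ⟨?_, ?_⟩
    · have h5 : (⌊a₀ - r - 3⌋ : ℝ) ≤ k := by
        have := Int.floor_le (a₀ - r - 3)
        linarith
      exact_mod_cast h5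
    · have h5 : (k : ℝ) ≤ ⌈b₀ - r + 3⌉ := by
        have := Int.le_ceil (b₀ - r + 3)
        linarith
      exact_mod_cast h5
  -- the measure of `Δ` in a unit interval
  have hmeas : ∀ a : ℝ, volume (Δ ∩ Icc a (a + 1)) < ENNReal.ofReal (1 / 2) := by
    intro a
    obtain ⟨S, hS⟩ : ∃ S : Finset ℤ, S = Finset.Icc ⌈a₀ - a - 2⌉ ⌊b₀ - a + 1⌋ := ⟨_, rfl⟩
    have hcover : Δ ∩ Icc a (a + 1) ⊆ ⋃ k ∈ S, (fun r : ℝ => (k : ℝ) + r) ⁻¹' Δ₁ := by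
      rintro r ⟨hr, hra1, hra2⟩
      obtain ⟨k, hk⟩ := (hmemΔ r).1 hr
      obtain ⟨h1, h2⟩ := hΔ₁bd _ hk
      refine mem_iUnion₂.2 ⟨k, ?_, hk⟩
      rw [hS, Finset.mem_Icc]
      exact ⟨Int.ceil_le.2 (by linarith), Int.le_floor.2 (by linarith)⟩
    have hcard : (S.card : ℝ) ≤ w + 4 := by
      rw [hS, Int.card_Icc]
      have h1 := Int.floor_le (b₀ - a + 1)
      have h2 := Int.le_ceil (a₀ - a - 2)
      rcases le_or_gt 0 (⌊b₀ - a + 1⌋ + 1 - ⌈a₀ - a - 2⌉) with hz | hz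
      · have h3 : (((⌊b₀ - a + 1⌋ + 1 - ⌈a₀ - a - 2⌉).toNat : ℤ) : ℝ) =
            ((⌊b₀ - a + 1⌋ + 1 - ⌈a₀ - a - 2⌉ : ℤ) : ℝ) := by
          exact_mod_cast Int.toNat_of_nonneg hz
        rw [← Int.cast_natCast, h3]
        push_cast
        linarith
      · rw [Int.toNat_eq_zero.2 hz.le]
        push_cast
        linarith
    have hlt : (w + 4) * ε < 1 / 2 := by
      have hw8 : (0 : ℝ) < 2 * (w + 8) := by positivity
      have h1 : (w + 4) * ε = (w + 4) / (2 * (w + 8)) := by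
        rw [hε]
        ring
      rw [h1, div_lt_iff₀ hw8]
      linarith
    calc volume (Δ ∩ Icc a (a + 1))
        ≤ volume (⋃ k ∈ S, (fun r : ℝ => (k : ℝ) + r) ⁻¹' Δ₁) := measure_mono hcover
      _ ≤ ∑ k ∈ S, volume ((fun r : ℝ => (k : ℝ) + r) ⁻¹' Δ₁) := measure_biUnion_finset_le S _
      _ = ∑ k ∈ S, volume Δ₁ := by
          refine Finset.sum_congr rfl fun k _ => ?_
          exact measure_preimage_add volume (k : ℝ) Δ₁
      _ = S.card * volume Δ₁ := by rw [Finset.sum_const, nsmul_eq_mul]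
      _ ≤ S.card * ENNReal.ofReal ε := by gcongr
      _ = ENNReal.ofReal (S.card * ε) := by
          rw [ENNReal.ofReal_mul (Nat.cast_nonneg _), ENNReal.ofReal_natCast]
      _ ≤ ENNReal.ofReal ((w + 4) * ε) :=
          ENNReal.ofReal_le_ofReal (mul_le_mul_of_nonneg_right hcard hε0.le)
      _ < ENNReal.ofReal (1 / 2) := (ENNReal.ofReal_lt_ofReal_iff (by norm_num)).2 hlt
  -- (iii) the lower bound off `Δ`
  obtain ⟨F'', hF''⟩ : ∃ F'' : Set D.End, F'' = F ∩ f ⁻¹' (thickening δ V)ᶜ := ⟨_, rfl⟩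
  have hF''c : IsCompact F'' :=
    hF'' ▸ hFc.inter_right ((isOpen_thickening.isClosed_compl).preimage hfc)
  have hne0 : ∀ x ∈ F'', D.dEnd τ x ≠ 0 := by
    intro x hx h0
    rw [hF''] at hx
    exact hx.2 (hVth (hV ▸ ⟨x, ⟨hx.1, h0⟩, rfl⟩))
  obtain ⟨q, hq, hqF⟩ : ∃ q : ℝ, 0 < q ∧ ∀ x ∈ F'', q ≤ ‖D.dEnd τ x‖ := by
    rcases F''.eq_empty_or_nonempty with h | hne
    · refine ⟨1, one_pos, fun x hx => ?_⟩
      rw [h] at hx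
      exact hx.elim
    · obtain ⟨x₀, hx₀, hmin⟩ := hF''c.exists_isMinOn hne hnc.continuousOn
      exact ⟨‖D.dEnd τ x₀‖, norm_pos_iff.2 (hne0 x₀ hx₀), fun x hx => hmin hx⟩
  have hNF'' : ∀ x ∈ F'', q ^ 2 / M ≤ N x := fun x hx => by
    have hxF : x ∈ F := by
      rw [hF''] at hx
      exact hx.1
    have h1 := sq_norm_le_of_upper g x hR hM (fun v => (hmM x hxF v).2) (D.dEnd τ x)
    have h2 : q ^ 2 ≤ ‖D.dEnd τ x‖ ^ 2 := pow_le_pow_left₀ hq.le (hqF x hx) 2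
    rw [hNy, div_le_iff₀ hM]
    calc q ^ 2 ≤ ‖D.dEnd τ x‖ ^ 2 := h2
      _ ≤ M * _ := h1
      _ = _ * M := mul_comm _ _
  obtain ⟨b₁, hb₁⟩ : ∃ b₁ : ℝ, b₁ = Real.sqrt (q ^ 2 / M) := ⟨_, rfl⟩
  have hb₁0 : 0 < b₁ := by
    rw [hb₁]
    exact Real.sqrt_pos.2 (by positivity)
  obtain ⟨b, hb⟩ : ∃ b : ℝ, b = min (b₁ / 2) (c / 2) := ⟨_, rfl⟩
  have hb0 : 0 < b := by
    rw [hb]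
    exact lt_min (by positivity) (by positivity)
  have hbc : b < c := by
    rw [hb]
    exact (min_le_right _ _).trans_lt (by linarith)
  have hlower : ∀ y : D.End, τ y ∉ Δ → b < Real.sqrt (N y) := fun y hy => by
    obtain ⟨x, hxF, hNx, -, k, hk⟩ := hrel y
    have hxΔ₁ : f x ∉ Δ₁ := fun hx1 => by
      refine hy ((hmemΔ (τ y)).2 ⟨-k, ?_⟩)
      have h1 : (((-k : ℤ) : ℝ)) + τ y = f x := by
        rw [← hfy, hk]
        push_cast
        ring
      rw [h1]
      exact hx1
    have hxF'' : x ∈ F'' := by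
      rw [hF'']
      exact ⟨hxF, fun hxV => hxΔ₁ (hthΔ₁ hxV)⟩
    rw [hNx]
    calc b ≤ b₁ / 2 := hb ▸ min_le_left _ _
      _ < b₁ := by linarith
      _ ≤ Real.sqrt (N x) := hb₁ ▸ Real.sqrt_le_sqrt (hNF'' x hxF'')
  refine ⟨b, c, hb0, hbc, Δ, hΔc, hmeas, fun y => ?_, fun y hy => ?_⟩
  · rw [← hNy]
    exact hupper y
  · rw [← hNy]
    exact hlower y hy

/-- **Hypothesis (2) for `M_∞`.** A metric `gInf` on the end which agrees with the `σ`-invariant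
metric `g` beyond the first ring — as the `M_∞` of `exists_endPeriodicMetrics` agrees with
`π^* g_Y` on `σ(U) ∖ ⋂ₖ σ^[k](U)` — has the same gradient lengths there (`gradNormSq_congr`), so
the bounds of `exists_gradient_bounds` hold for `gInf` at every point of `σ(U) ∖ ⋂ₖ σ^[k](U)`
(all rings but the zeroth, i.e. "for `N` large" in App. B). [cite: DeMichelisFreedman1992, App. B (p. 251), §2 (p. 223)] -/
theorem exists_gradient_bounds_of_eqOn
    (g gInf : PseudoRiemannianMetric 𝓘(ℝ, E) ∞ E (TangentSpace 𝓘(ℝ, E) : D.End → Type _))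
    (hR : g.IsRiemannian)
    (hg : ∀ y, pullbackBilin (I := 𝓘(ℝ, E)) (I' := 𝓘(ℝ, E)) D.deck g.val y = g.val y)
    (hInf : ∀ y : D.End, (y : D.U) ∈ range D.σ → gInf.val y = g.val y)
    (τ : D.U → ℝ) (hτ : ContMDiffOn 𝓘(ℝ, E) 𝓘(ℝ) ∞ τ (⋂ k, range (D.σ^[k]))ᶜ)
    (hshift : ∀ x, x ∉ (⋂ k, range (D.σ^[k])) → τ (D.σ x) = τ x + 1) :
    ∃ b c : ℝ, 0 < b ∧ b < c ∧ ∃ Δ : Set ℝ, IsClosed Δ ∧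
      (∀ a : ℝ, volume (Δ ∩ Icc a (a + 1)) < ENNReal.ofReal (1 / 2)) ∧
      (∀ y : D.End, (y : D.U) ∈ range D.σ → Real.sqrt (D.gradNormSq gInf τ y) < c) ∧
      (∀ y : D.End, (y : D.U) ∈ range D.σ → τ y ∉ Δ →
        b < Real.sqrt (D.gradNormSq gInf τ y)) := by
  obtain ⟨b, c, hb, hbc, Δ, hΔ, hmeas, hup, hlow⟩ := D.exists_gradient_bounds g hR hg τ hτ hshift
  refine ⟨b, c, hb, hbc, Δ, hΔ, hmeas, fun y hy => ?_, fun y hy hyΔ => ?_⟩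
  · rw [D.gradNormSq_congr (hInf y hy)]
    exact hup y
  · rw [D.gradNormSq_congr (hInf y hy)]
    exact hlow y hyΔ

end GradientBounds

end EndPeriodicData

/-! ### The polar family: the link is a round sphere; (1) and (2) packaged -/

section Polar

open EndPeriodic EndPeriodicData Literature.Geometry.Lorentzian
  Literature.Geometry.Lorentzian.PseudoRiemannianMetric

variable {E : Type*} [NormedAddCommGroup E] [NormedSpace ℝ E] [FiniteDimensional ℝ E]
  {R : Opens E} {e : R ≃ₜ E} {s t : ℝ}

/-- **The link of the polar end is the polar sphere `{(1 - s) ‖e x‖ = 1}`**: for the data of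
`polarEndPeriodicData` (`C = {(1 - s) ‖e ·‖ ≤ 1}`, `σ(U) = R⁴_s = {(1 - s) ‖e ·‖ < 1}`).
[cite: DeMichelisFreedman1992, §2 (p. 222), App. B (p. 251)] -/
theorem polar_link_eq (hst : s < t) (hs1 : s < 1)
    (d : polarBall R e s ≃ₘ⟮𝓘(ℝ, E), 𝓘(ℝ, E)⟯ polarBall R e t) :
    (polarEndPeriodicData hst hs1 d).C \ range (polarEndPeriodicData hst hs1 d).σ =
      {x : polarBall R e t | ∃ hx : (x : E) ∈ R, (1 - s) * ‖e ⟨x, hx⟩‖ = 1} := by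
  ext x
  have hσ : ∀ y : polarBall R e t,
      y ∈ range (polarEndPeriodicData hst hs1 d).σ ↔ (y : E) ∈ polarBall R e s := fun y =>
    Set.ext_iff.1 (range_inclusion_comp_symm hst.le d) y
  constructor
  · rintro ⟨hxC, hxr⟩
    have hxC' : ∃ hx : (x : E) ∈ R, (1 - s) * ‖e ⟨x, hx⟩‖ ≤ 1 := hxC
    obtain ⟨hxR, hle⟩ := hxC'
    exact ⟨hxR, le_antisymm hle
      (not_lt.1 fun h => hxr ((hσ x).2 ((mem_polarBall R e).2 ⟨hxR, h⟩)))⟩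
  · rintro ⟨hxR, heq⟩
    refine ⟨(⟨hxR, heq.le⟩ : ∃ hx : (x : E) ∈ R, (1 - s) * ‖e ⟨x, hx⟩‖ ≤ 1), fun hxr => ?_⟩
    obtain ⟨hxR', hlt⟩ := (mem_polarBall R e).1 ((hσ x).1 hxr)
    rw [show (⟨(x : E), hxR'⟩ : R) = ⟨x, hxR⟩ from rfl] at hlt
    linarith

/-- **The polar sphere is homeomorphic to the unit sphere of `E`** (`S³` for `E = ℝ⁴`): the
homeomorphism `e` followed by the dilation by `1 - s > 0`; the inverse lands in `R⁴_t` because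
`s < t`. This is the "topological 3-sphere" of App. B (1) for the polar end.
[cite: DeMichelisFreedman1992, App. B (p. 251), Thm. 3.2 (p. 244)] -/
def polarLinkHomeomorph (hst : s < t) (hs1 : s < 1) :
    {x : polarBall R e t | ∃ hx : (x : E) ∈ R, (1 - s) * ‖e ⟨x, hx⟩‖ = 1} ≃ₜ sphere (0 : E) 1 :=
  have hs0 : (0 : ℝ) < 1 - s := by linarith
  have hmem : ∀ y : sphere (0 : E) 1,
      ((e.symm ((1 - s)⁻¹ • (y : E)) : R) : E) ∈ polarBall R e t := fun y => by
    refine (mem_polarBall R e).2 ⟨(e.symm ((1 - s)⁻¹ • (y : E))).2, ?_⟩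
    rw [Subtype.coe_eta, e.apply_symm_apply, norm_smul, norm_inv, Real.norm_eq_abs,
      abs_of_pos hs0, mem_sphere_zero_iff_norm.1 y.2, mul_one, ← div_eq_mul_inv, div_lt_one hs0]
    linarith
  { toFun := fun x => ⟨(1 - s) • e ⟨(x.1 : E), x.2.fst⟩, by
      rw [mem_sphere_zero_iff_norm, norm_smul, Real.norm_eq_abs, abs_of_pos hs0, x.2.snd]⟩
    invFun := fun y => ⟨⟨((e.symm ((1 - s)⁻¹ • (y : E)) : R) : E), hmem y⟩,
      (e.symm ((1 - s)⁻¹ • (y : E))).2, by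
        rw [Subtype.coe_eta, e.apply_symm_apply, norm_smul, norm_inv, Real.norm_eq_abs,
          abs_of_pos hs0, mem_sphere_zero_iff_norm.1 y.2, mul_one, mul_inv_cancel₀ hs0.ne']⟩
    left_inv := fun x => by
      apply Subtype.ext
      apply Subtype.ext
      simp only [smul_smul, inv_mul_cancel₀ hs0.ne', one_smul, Homeomorph.symm_apply_apply]
    right_inv := fun y => by
      apply Subtype.ext
      simp only [Subtype.coe_eta, Homeomorph.apply_symm_apply, smul_smul,
        mul_inv_cancel₀ hs0.ne', one_smul]
    continuous_toFun := by
      refine Continuous.subtype_mk (continuous_const.smul (e.continuous.comp ?_)) _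
      exact (continuous_subtype_val.comp continuous_subtype_val).subtype_mk _
    continuous_invFun := by
      refine Continuous.subtype_mk (Continuous.subtype_mk ?_ _) _
      exact continuous_subtype_val.comp
        (e.symm.continuous.comp (continuous_const.smul continuous_subtype_val)) }

/-- **The link of the polar end is a topological sphere** (the unit sphere of `E`).
[cite: DeMichelisFreedman1992, App. B (p. 251)] -/
theorem nonempty_polar_link_homeomorph_sphere (hst : s < t) (hs1 : s < 1)
    (d : polarBall R e s ≃ₘ⟮𝓘(ℝ, E), 𝓘(ℝ, E)⟯ polarBall R e t) :
    Nonempty (((polarEndPeriodicData hst hs1 d).C \ range (polarEndPeriodicData hst hs1 d).σ :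
      Set (polarBall R e t)) ≃ₜ sphere (0 : E) 1) := by
  exact ⟨(Homeomorph.setCongr (polar_link_eq hst hs1 d)).trans (polarLinkHomeomorph hst hs1)⟩

end Polar

/-! ### (1) and (2) for the end produced by a diffeomorphism `d : R⁴_s ≅ R⁴_t` -/

section PolarPackage

open EndPeriodic EndPeriodicData Literature.Geometry.Lorentzian
  Literature.Geometry.Lorentzian.PseudoRiemannianMetric

variable {E : Type} [NormedAddCommGroup E] [NormedSpace ℝ E] [FiniteDimensional ℝ E]
  {R : Opens E} {e : R ≃ₜ E} {s t : ℝ}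

/-- **The hypotheses (1)–(2) of Appendix B hold for the end-periodic end of the polar family**
(the end `R⁴_t ∖ ⋂ₖ R⁴_k` that a diffeomorphism `d : R⁴_s ≅ R⁴_t`, `s < t`, `s < 1`, produces,
`polarEndPeriodicData`; `D.U = R⁴_t`, `D.σ = incl ∘ d⁻¹`, `R⁴_k = σ^[k](R⁴_t)`), for the metric
`M_∞ = gInf` of `exists_endPeriodicMetrics_of_diffeomorph` (any metric on the end agreeing with
the pulled-back metric `π^* g_Y` beyond the first ring): there is a Taubes height function `τ ≥ 0`,
`C^∞` on the end, `τ ∘ σ = τ + 1`, such that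
* (1) the link `L = C ∖ σ(U)` of the fundamental domain is a topological sphere (the unit sphere
  of `E`; `S³` for `E = ℝ⁴`) whose iterates `σ^[k](L)` lie in the segments `{k ≤ τ ≤ k + 1}`
  (each separating `R⁴_t`, `compl_image_iterate_link`);
* (2) there are `0 < b < c` and a closed `Δ ⊆ ℝ` meeting every `[a, a + 1]` in measure `< ½`
  with `|grad τ|_{gInf} < c` on `σ(U) ∖ ⋂ₖ R⁴_k` and `> b` there off `τ⁻¹(Δ)`.
The decay estimates (B.1)–(B.9) that App. B draws from (1)–(2) for an ASD connection are not
formalized. [cite: DeMichelisFreedman1992, App. B (p. 251), §2 (p. 223), proof of Thm. 4.1 (p. 247)] -/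
theorem exists_boundedGeometry_of_diffeomorph (hst : s < t) (hs1 : s < 1)
    (d : polarBall R e s ≃ₘ⟮𝓘(ℝ, E), 𝓘(ℝ, E)⟯ polarBall R e t)
    (gY : PseudoRiemannianMetric 𝓘(ℝ, E) ∞ E
      (TangentSpace 𝓘(ℝ, E) : OrbitSpace (polarEndPeriodicData hst hs1 d).σ → Type _))
    (hgY : gY.IsRiemannian)
    (gInf : PseudoRiemannianMetric 𝓘(ℝ, E) ∞ E
      (TangentSpace 𝓘(ℝ, E) : (polarEndPeriodicData hst hs1 d).End → Type _))
    (hInf : ∀ y : (polarEndPeriodicData hst hs1 d).End,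
      (y : (polarEndPeriodicData hst hs1 d).U) ∈ range (polarEndPeriodicData hst hs1 d).σ →
        gInf.val y = ((polarEndPeriodicData hst hs1 d).coverMetric gY).val y) :
    Nonempty (((polarEndPeriodicData hst hs1 d).C \ range (polarEndPeriodicData hst hs1 d).σ :
        Set (polarBall R e t)) ≃ₜ sphere (0 : E) 1) ∧
    ∃ τ : (polarEndPeriodicData hst hs1 d).U → ℝ,
      ContMDiffOn 𝓘(ℝ, E) 𝓘(ℝ) ∞ τ (⋂ k, range ((polarEndPeriodicData hst hs1 d).σ^[k]))ᶜ ∧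
      (∀ x, 0 ≤ τ x) ∧
      (∀ x, x ∉ (⋂ k, range ((polarEndPeriodicData hst hs1 d).σ^[k])) →
        τ ((polarEndPeriodicData hst hs1 d).σ x) = τ x + 1) ∧
      (∀ (k : ℕ) (x : (polarEndPeriodicData hst hs1 d).U),
        x ∈ (polarEndPeriodicData hst hs1 d).σ^[k] ''
          ((polarEndPeriodicData hst hs1 d).C \ range (polarEndPeriodicData hst hs1 d).σ) →
          (k : ℝ) ≤ τ x ∧ τ x ≤ k + 1) ∧
      ∃ b c : ℝ, 0 < b ∧ b < c ∧ ∃ Δ : Set ℝ, IsClosed Δ ∧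
        (∀ a : ℝ, volume (Δ ∩ Icc a (a + 1)) < ENNReal.ofReal (1 / 2)) ∧
        (∀ y : (polarEndPeriodicData hst hs1 d).End,
          (y : (polarEndPeriodicData hst hs1 d).U) ∈ range (polarEndPeriodicData hst hs1 d).σ →
            Real.sqrt ((polarEndPeriodicData hst hs1 d).gradNormSq gInf τ y) < c) ∧
        (∀ y : (polarEndPeriodicData hst hs1 d).End,
          (y : (polarEndPeriodicData hst hs1 d).U) ∈ range (polarEndPeriodicData hst hs1 d).σ →
            τ y ∉ Δ → b < Real.sqrt ((polarEndPeriodicData hst hs1 d).gradNormSq gInf τ y)) := by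
  refine ⟨nonempty_polar_link_homeomorph_sphere hst hs1 d, ?_⟩
  obtain ⟨τ, hτ, hτ0, hshift, hlower, hupper⟩ :=
    (polarEndPeriodicData hst hs1 d).exists_smooth_height_function
  obtain ⟨b, c, hb, hbc, Δ, hΔ, hmeas, hup, hlow⟩ :=
    (polarEndPeriodicData hst hs1 d).exists_gradient_bounds_of_eqOn
      ((polarEndPeriodicData hst hs1 d).coverMetric gY) gInf
      ((polarEndPeriodicData hst hs1 d).isRiemannian_coverMetric hgY)
      ((polarEndPeriodicData hst hs1 d).pullbackBilin_deck_coverMetric gY) hInf τ hτ hshift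
  exact ⟨τ, hτ, hτ0, hshift,
    fun k x hx => (polarEndPeriodicData hst hs1 d).height_mem_Icc_of_mem_image_iterate_link
      hlower hupper k hx,
    b, c, hb, hbc, Δ, hΔ, hmeas, hup, hlow⟩

end PolarPackage

end Literature.Barriers.SmoothPoincare4
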